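import Literature.Analysis.FluidPDE.KNSSSwirlLiouville
import Literature.Analysis.FluidPDE.MeridianReduction
import Literature.Analysis.FluidPDE.SpaceTimeRescaling
import HarnessLib

/-!
# KNSS 2009, proof of Theorem 5.3: the swirl pair, its normalisation and its rescaling

Analysis/FluidPDE support file (all results proved) on the decomposition path of the named fact
`Literature.Analysis.FluidPDE.KNSS2009_swirl_sup_nonpos` (`KNSSSwirlLiouville`: the scaling and
cut-off argument of Koch–Nadirashvili–Seregin–Šverák, Acta Math. 203 (2009) = arXiv:0709.3599,
proof of Theorem 5.3, p. 10, from Lemma 2.1). It packages the hypotheses of that fact — a scalar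
`f` (the swirl) and a drift `u` on `ℝ³ × (−∞, τ)` with the swirl equation (5.10) off the axis,
`|f| ≤ C_f` (5.12), `|u| ≤ C_u / r` (5.13), `f = 0` on the axis — into the predicate
`IsKNSSSwirlPair C_f C_u τ f u`, and proves the two reductions used on p. 10 before Lemma 2.1 is
applied:

* **normalisation of the drift** (`IsKNSSSwirlPair.of_ae`): the drift bound (5.13) is an `L^∞`
  statement and is assumed in the fact for a.e. `t` only; redefining `u` as `0` on the
  exceptional null set of times changes no time integral of the equation and gives the bound at
  every time;
* **scaling and translation covariance** (`IsKNSSSwirlPair.rescale`): "For `λ > 0` we let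
  `f^λ(x,t) = f(λx, λ²t)` and `u^λ(x,t) = λu(λx, λ²t)`. We note that `f^λ` again satisfies (5.10)
  with `u` replaced by `u^λ` … `|f^λ| ≤ C`, `|u^λ| ≤ C/r` uniformly in `λ > 0`" (p. 10,
  (5.11)–(5.13)), combined with a translation along the axis and in time (the equation has
  coefficients depending on `r` only): for `λ > 0`, `t* < τ`, `z̄ ∈ ℝ`, `T ∈ ℝ` the pair
  `F(s, y) = f(t* + λ²(s − T), z̄ e_z + λ y)`, `V(s, y) = λ u(t* + λ²(s − T), z̄ e_z + λ y)` is
  again a swirl pair, with the same constants, on `s < T + (τ − t*)/λ²` (so in particular on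
  `s ≤ T`), realised with the tree's space–time pull-back `stPull` (`SpaceTimeRescaling`).

## References

* G. Koch, N. Nadirashvili, G. Seregin, V. Šverák, *Liouville theorems for the Navier–Stokes
  equations and applications*, Acta Math. 203 (2009) = arXiv:0709.3599, proof of Theorem 5.3,
  (5.10)–(5.14), p. 10. [KochNadirashviliSereginSverak2009]
-/

noncomputable section

open MeasureTheory Set Function Filter Topology TopologicalSpace InnerProductSpace WithLp
open scoped Laplacian RealInnerProductSpace ContDiff

namespace Literature.Analysis.FluidPDE

/-- Local notation for physical space `ℝ³ = EuclideanSpace ℝ (Fin 3)`. -/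
local notation "ℝ³" => EuclideanSpace ℝ (Fin 3)

/-! ### The swirl pair -/

/-- **A KNSS swirl pair on `ℝ³ × (−∞, τ)`**: the hypotheses of `KNSS2009_swirl_sup_nonpos`
(Koch–Nadirashvili–Seregin–Šverák 2009, proof of Theorem 5.3, arXiv:0709.3599 p. 10) for a scalar
`f` and a drift `u`, with the drift bound at every time and a general final time `τ` (the fact
has `τ = 0` and the drift bound for a.e. time; `IsKNSSSwirlPair.of_ae`): smooth slices with
`∇f`, `Δf` jointly continuous, `f` axisymmetric, `f = 0` on the axis, `|f| ≤ C_f` ((5.12)),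
`u` jointly measurable with smooth divergence-free slices and `r|u| ≤ C_u` ((5.13)), and the swirl
equation (5.10) off the axis in time-integrated form. [cite: KochNadirashviliSereginSverak2009, proof of Thm 5.3, (5.10)–(5.13) (arXiv p. 10)] -/
structure IsKNSSSwirlPair (Cf Cu τ : ℝ) (f : ℝ → ℝ³ → ℝ) (u : ℝ → ℝ³ → ℝ³) : Prop where
  smooth : ∀ t < τ, ContDiff ℝ ∞ (f t)
  continuousOn_fderiv : ContinuousOn (fun p : ℝ × ℝ³ => fderiv ℝ (f p.1) p.2) (Iio τ ×ˢ univ)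
  continuousOn_laplacian : ContinuousOn (fun p : ℝ × ℝ³ => (Δ (f p.1)) p.2) (Iio τ ×ˢ univ)
  axisymmetric : ∀ t < τ, IsAxisymmetricScalar (f t)
  axis : ∀ t < τ, ∀ x, cylRadius x = 0 → f t x = 0
  abs_le : ∀ t < τ, ∀ x, |f t x| ≤ Cf
  measurable_drift : Measurable (uncurry u)
  smooth_drift : ∀ t < τ, ContDiff ℝ ∞ (u t)
  divFree : ∀ t < τ, VectorCalculus.IsDivFree (u t)
  drift_le : ∀ t < τ, ∀ x, cylRadius x * ‖u t x‖ ≤ Cu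
  eqn : ∀ x, cylRadius x ≠ 0 → ∀ s t : ℝ, s ≤ t → t < τ →
    f t x - f s x = ∫ r in s..t, ((Δ (f r)) x - fderiv ℝ (f r) x (u r x) -
      2 / cylRadius x * partialDeriv (eR x) (f r) x)

namespace IsKNSSSwirlPair

variable {Cf Cu τ : ℝ} {f : ℝ → ℝ³ → ℝ} {u : ℝ → ℝ³ → ℝ³}

/-- `C_f ≥ 0`. [folklore] -/
theorem Cf_nonneg (h : IsKNSSSwirlPair Cf Cu τ f u) : 0 ≤ Cf :=
  (abs_nonneg _).trans (h.abs_le (τ - 1) (by linarith) 0)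

/-- `C_u ≥ 0`. [folklore] -/
theorem Cu_nonneg (h : IsKNSSSwirlPair Cf Cu τ f u) : 0 ≤ Cu :=
  (mul_nonneg (cylRadius_nonneg _) (norm_nonneg _)).trans (h.drift_le (τ - 1) (by linarith) 0)

/-- Restriction to an earlier final time. [folklore] -/
theorem mono (h : IsKNSSSwirlPair Cf Cu τ f u) {τ' : ℝ} (hτ : τ' ≤ τ) : IsKNSSSwirlPair Cf Cu τ' f u where
  smooth t ht := h.smooth t (lt_of_lt_of_le ht hτ)
  continuousOn_fderiv := h.continuousOn_fderiv.mono (prod_mono (Iio_subset_Iio hτ) Subset.rfl)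
  continuousOn_laplacian := h.continuousOn_laplacian.mono (prod_mono (Iio_subset_Iio hτ) Subset.rfl)
  axisymmetric t ht := h.axisymmetric t (lt_of_lt_of_le ht hτ)
  axis t ht := h.axis t (lt_of_lt_of_le ht hτ)
  abs_le t ht := h.abs_le t (lt_of_lt_of_le ht hτ)
  measurable_drift := h.measurable_drift
  smooth_drift t ht := h.smooth_drift t (lt_of_lt_of_le ht hτ)
  divFree t ht := h.divFree t (lt_of_lt_of_le ht hτ)
  drift_le t ht := h.drift_le t (lt_of_lt_of_le ht hτ)
  eqn x hx s t hst ht := h.eqn x hx s t hst (lt_of_lt_of_le ht hτ)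

end IsKNSSSwirlPair

/-! ### Normalisation of the drift on a null set of times -/

/-- **The hypotheses of `KNSS2009_swirl_sup_nonpos` give a swirl pair after redefining the drift
on a null set of times** (the bound (5.13) `|u| ≤ C/r` is an `L^∞` statement; setting `u = 0` at
the exceptional times changes no time integral of the equation). [cite: KochNadirashviliSereginSverak2009, proof of Thm 5.3, (5.13) (arXiv p. 10)] -/
theorem IsKNSSSwirlPair.of_ae {f : ℝ → ℝ³ → ℝ} {u : ℝ → ℝ³ → ℝ³} {Cf Cu : ℝ}
    (h1 : ∀ t < 0, ContDiff ℝ ∞ (f t))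
    (h2 : ContinuousOn (fun p : ℝ × ℝ³ => fderiv ℝ (f p.1) p.2) (Iio 0 ×ˢ univ))
    (h3 : ContinuousOn (fun p : ℝ × ℝ³ => (Δ (f p.1)) p.2) (Iio 0 ×ˢ univ))
    (h4 : ∀ t < 0, IsAxisymmetricScalar (f t))
    (h5 : ∀ t < 0, ∀ x, cylRadius x = 0 → f t x = 0)
    (h6 : ∀ t < 0, ∀ x, |f t x| ≤ Cf)
    (h7 : Measurable (uncurry u))
    (h8 : ∀ t < 0, ContDiff ℝ ∞ (u t)) (h9 : ∀ t < 0, VectorCalculus.IsDivFree (u t))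
    (h10 : ∀ᵐ t ∂((volume : Measure ℝ).restrict (Iio 0)), ∀ x, cylRadius x * ‖u t x‖ ≤ Cu)
    (h11 : ∀ x, cylRadius x ≠ 0 → ∀ s t : ℝ, s ≤ t → t < 0 →
      f t x - f s x = ∫ r in s..t, ((Δ (f r)) x - fderiv ℝ (f r) x (u r x) -
        2 / cylRadius x * partialDeriv (eR x) (f r) x)) :
    ∃ u' : ℝ → ℝ³ → ℝ³, IsKNSSSwirlPair Cf (max Cu 0) 0 f u' := by
  classical
  -- a measurable null set of times containing the exceptional ones
  set S : Set ℝ := {t | ¬ ∀ x, cylRadius x * ‖u t x‖ ≤ Cu} ∩ Iio 0 with hS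
  have hS0 : volume S = 0 := by
    have h := ae_iff.1 h10
    rwa [Measure.restrict_apply' measurableSet_Iio] at h
  set N : Set ℝ := toMeasurable volume S with hN
  have hNm : MeasurableSet N := measurableSet_toMeasurable _ _
  have hN0 : volume N = 0 := by rw [hN, measure_toMeasurable]; exact hS0
  have hgood : ∀ t < 0, t ∉ N → ∀ x, cylRadius x * ‖u t x‖ ≤ Cu := by
    intro t ht htN
    by_contra hbad
    exact htN (subset_toMeasurable _ _ ⟨hbad, ht⟩)
  -- the normalised drift
  set u' : ℝ → ℝ³ → ℝ³ := fun t x => if t ∈ N then 0 else u t x with hu'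
  refine ⟨u', ?_⟩
  have hslice : ∀ t, u' t = if t ∈ N then 0 else u t := by
    intro t; funext x; by_cases ht : t ∈ N <;> simp [hu', ht]
  refine ⟨h1, h2, h3, h4, h5, h6, ?_, ?_, ?_, ?_, ?_⟩
  · -- measurability
    have hset : MeasurableSet {p : ℝ × ℝ³ | p.1 ∈ N} := measurable_fst hNm
    show Measurable fun p : ℝ × ℝ³ => u' p.1 p.2
    simp only [hu']
    exact Measurable.ite hset measurable_const h7
  · intro t ht
    rw [hslice t]
    split_ifs
    · exact contDiff_const
    · exact h8 t ht
  · intro t ht x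
    rw [hslice t]
    split_ifs
    · simp [VectorCalculus.divergence]
    · exact h9 t ht x
  · intro t ht x
    rw [hslice t]
    split_ifs with htN
    · simp only [Pi.zero_apply, norm_zero, mul_zero]
      exact le_max_right _ _
    · exact (hgood t ht htN x).trans (le_max_left _ _)
  · intro x hx s t hst ht
    rw [h11 x hx s t hst ht]
    refine intervalIntegral.integral_congr_ae ?_
    have hae : ∀ᵐ r ∂(volume : Measure ℝ), r ∉ N := by
      rw [ae_iff]
      simpa using hN0
    filter_upwards [hae] with r hr _
    simp [hu', hr]

/-! ### Scaling and translation covariance -/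

section Rescale

/-- `r(z̄ e_z + λ y) = |λ| r(y)`: axial translations do not change the distance to the axis
(the tree's `SereginSverak2009.cylRadius_smul_eZ_add`), scalings multiply it (`cylRadius_smul`).
[folklore] -/
theorem cylRadius_smul_eZ_add_smul (z c : ℝ) (y : ℝ³) :
    cylRadius (z • eZ + c • y) = |c| * cylRadius y := by
  rw [SereginSverak2009.cylRadius_smul_eZ_add, cylRadius_smul]

/-- `e_r(z̄ e_z + λ y) = e_r(y)` for `λ > 0`. [folklore] -/
theorem eR_smul_eZ_add_smul (z : ℝ) {c : ℝ} (hc : 0 < c) (y : ℝ³) :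
    eR (z • eZ + c • y) = eR y := by
  rw [eR, eR, cylRadius_smul_eZ_add_smul, abs_of_pos hc]
  by_cases hy : cylRadius y = 0
  · simp [hy]
  · have h0 : (z • eZ + c • y) 0 = c * y 0 := by simp [eZ]
    have h1 : (z • eZ + c • y) 1 = c * y 1 := by simp [eZ]
    rw [h0, h1]
    ext i
    fin_cases i <;> simp <;> field_simp

variable {Cf Cu τ : ℝ} {f : ℝ → ℝ³ → ℝ} {u : ℝ → ℝ³ → ℝ³}

/-- **Scaling and translation covariance of swirl pairs** (KNSS 2009, p. 10, (5.11)–(5.13):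
`f^λ(x,t) = f(λx, λ²t)`, `u^λ = λu(λx, λ²t)` "again satisfies (5.10) … `|f^λ| ≤ C`,
`|u^λ| ≤ C/r` uniformly in `λ > 0`", composed with a translation by `z̄ e_z` along the axis and a
translation in time). With `Φ(s, y) = (t* − λ²T + λ² s, z̄ e_z + λ y)` (the tree's
`stAffine (λ²) λ (t* − λ²T) (z̄ e_z)`), the pair `F = f ∘ Φ = stPull … f`, `V = λ (u ∘ Φ)` is a
swirl pair with the same constants up to the time `T + (τ − t*)/λ²`, and `F(T, y) = f(t*, z̄e_z + λy)`.
[cite: KochNadirashviliSereginSverak2009, proof of Thm 5.3, (5.11)–(5.13) (arXiv p. 10)] -/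
theorem IsKNSSSwirlPair.rescale (h : IsKNSSSwirlPair Cf Cu τ f u) {lam : ℝ} (hlam : 0 < lam)
    (tstar zbar T : ℝ) :
    IsKNSSSwirlPair Cf Cu (T + (τ - tstar) / lam ^ 2)
      (stPull (lam ^ 2) lam (tstar - lam ^ 2 * T) (zbar • eZ) f)
      (lam • stPull (lam ^ 2) lam (tstar - lam ^ 2 * T) (zbar • eZ) u) := by
  set β : ℝ := lam ^ 2 with hβ
  set t₀ : ℝ := tstar - lam ^ 2 * T with ht₀
  set x₀ : ℝ³ := zbar • eZ with hx₀
  have hβpos : 0 < β := by positivity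
  have hlam0 : lam ≠ 0 := hlam.ne'
  -- the time correspondence
  have htime : ∀ s, s < T + (τ - tstar) / lam ^ 2 ↔ t₀ + β * s < τ := by
    intro s
    rw [ht₀, hβ]
    constructor
    · intro hs
      have := (lt_div_iff₀ (by positivity : (0 : ℝ) < lam ^ 2)).1 (by linarith : s - T < (τ - tstar) / lam ^ 2)
      nlinarith
    · intro hs
      have h1 : (s - T) * lam ^ 2 < τ - tstar := by nlinarith
      have := (lt_div_iff₀ (by positivity : (0 : ℝ) < lam ^ 2)).2 h1
      linarith
  -- the space correspondence
  have hX : ∀ y : ℝ³, cylRadius (x₀ + lam • y) = lam * cylRadius y := fun y => by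
    rw [hx₀, cylRadius_smul_eZ_add_smul, abs_of_pos hlam]
  have heRX : ∀ y : ℝ³, eR (x₀ + lam • y) = eR y := fun y => eR_smul_eZ_add_smul zbar hlam y
  -- the affine map as a continuous map of `ℝ × ℝ³`
  have hΦc : Continuous fun p : ℝ × ℝ³ => (t₀ + β * p.1, x₀ + lam • p.2) := by fun_prop
  have hΦmaps : MapsTo (fun p : ℝ × ℝ³ => (t₀ + β * p.1, x₀ + lam • p.2))
      (Iio (T + (τ - tstar) / lam ^ 2) ×ˢ univ) (Iio τ ×ˢ univ) :=
    fun p hp => ⟨(htime p.1).1 hp.1, mem_univ _⟩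
  refine ⟨?_, ?_, ?_, ?_, ?_, ?_, ?_, ?_, ?_, ?_, ?_⟩
  · -- smooth slices
    intro s hs
    have hf := h.smooth _ ((htime s).1 hs)
    exact hf.comp (contDiff_const.add (contDiff_const_smul lam))
  · -- `∇F` jointly continuous: `∇F(s, y) = λ ∇f(Φ(s, y))`
    have hc := (h.continuousOn_fderiv.comp hΦc.continuousOn hΦmaps).const_smul lam
    refine hc.congr fun p _ => ?_
    simp only [Pi.smul_apply, comp_apply]
    exact fderiv_stPull β lam t₀ x₀ f p.1 p.2
  · -- `ΔF` jointly continuous: `ΔF(s, y) = λ² Δf(Φ(s, y))`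
    have hc := (h.continuousOn_laplacian.comp hΦc.continuousOn hΦmaps).const_smul (lam ^ 2)
    refine hc.congr fun p hp => ?_
    have h2 : ContDiff ℝ 2 (f (t₀ + β * p.1)) :=
      (h.smooth _ ((htime p.1).1 hp.1)).of_le (by norm_cast)
    simp only [Pi.smul_apply, comp_apply, smul_eq_mul]
    rw [laplacian_stPull β lam t₀ x₀ f p.1 p.2 h2, smul_eq_mul]
  · -- axisymmetric
    intro s hs θ y
    simp only [stPull_apply]
    rw [hx₀, ← SereginSverak2009.rotZ_smul_eZ_add_smul, h.axisymmetric _ ((htime s).1 hs) θ]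
  · -- zero on the axis
    intro s hs y hy
    simp only [stPull_apply]
    exact h.axis _ ((htime s).1 hs) _ (by rw [hX, hy, mul_zero])
  · -- bounded
    intro s hs y
    simp only [stPull_apply]
    exact h.abs_le _ ((htime s).1 hs) _
  · -- measurable drift
    have hm : Measurable fun p : ℝ × ℝ³ => (t₀ + β * p.1, x₀ + lam • p.2) := hΦc.measurable
    have hunc : uncurry (lam • stPull β lam t₀ x₀ u) =
        fun p : ℝ × ℝ³ => lam • uncurry u (t₀ + β * p.1, x₀ + lam • p.2) := by
      funext p; rfl
    rw [hunc]
    exact (h.measurable_drift.comp hm).const_smul lam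
  · -- smooth drift slices
    intro s hs
    have hu := h.smooth_drift _ ((htime s).1 hs)
    have hfun : (lam • stPull β lam t₀ x₀ u) s = fun y => lam • u (t₀ + β * s) (x₀ + lam • y) := by
      funext y; rfl
    rw [hfun]
    exact (hu.comp (contDiff_const.add (contDiff_const_smul lam))).const_smul lam
  · -- divergence free
    intro s hs y
    have hfun : (lam • stPull β lam t₀ x₀ u) s = lam • stPull β lam t₀ x₀ u s := rfl
    rw [hfun]
    have hd : DifferentiableAt ℝ (stPull β lam t₀ x₀ u s) y := by
      have hu := h.smooth_drift _ ((htime s).1 hs)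
      exact ((hu.comp (contDiff_const.add (contDiff_const_smul lam))).differentiable
        (by simp)) y
    rw [VectorCalculus.divergence, fderiv_const_smul hd, ContinuousLinearMap.toLinearMap_smul,
      LinearMap.map_smul, smul_eq_mul]
    have := divergence_stPull β lam t₀ x₀ u s y
    rw [VectorCalculus.divergence] at this
    rw [this, h.divFree _ ((htime s).1 hs) _, mul_zero, mul_zero]
  · -- drift bound `r |V| ≤ C_u`
    intro s hs y
    simp only [smul_stPull_apply, norm_smul, Real.norm_eq_abs, abs_of_pos hlam]
    have hb := h.drift_le _ ((htime s).1 hs) (x₀ + lam • y)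
    rw [hX] at hb
    nlinarith [hb, cylRadius_nonneg y, norm_nonneg (u (t₀ + β * s) (x₀ + lam • y))]
  · -- the equation: substitute `τ' = t₀ + β σ` in the time integral
    intro y hy s t hst ht
    have hyX : cylRadius (x₀ + lam • y) ≠ 0 := by rw [hX]; exact mul_ne_zero hlam0 hy
    set X : ℝ³ := x₀ + lam • y with hXdef
    set G : ℝ → ℝ := fun τ' => (Δ (f τ')) X - fderiv ℝ (f τ') X (u τ' X) -
      2 / cylRadius X * partialDeriv (eR X) (f τ') X with hG
    have hst' : t₀ + β * s ≤ t₀ + β * t := by nlinarith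
    have hsrc : f (t₀ + β * t) X - f (t₀ + β * s) X = ∫ τ' in (t₀ + β * s)..(t₀ + β * t), G τ' :=
      h.eqn X hyX (t₀ + β * s) (t₀ + β * t) hst' ((htime t).1 ht)
    -- the target integrand is `β G (t₀ + β σ)`
    have hint : EqOn (fun σ => (Δ (stPull β lam t₀ x₀ f σ)) y -
        fderiv ℝ (stPull β lam t₀ x₀ f σ) y ((lam • stPull β lam t₀ x₀ u) σ y) -
          2 / cylRadius y * partialDeriv (eR y) (stPull β lam t₀ x₀ f σ) y)
        (fun σ => β * G (t₀ + β * σ)) (uIcc s t) := by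
      intro σ hσ
      rw [uIcc_of_le hst] at hσ
      have hσ' : t₀ + β * σ < τ := lt_of_le_of_lt (by nlinarith [hσ.2]) ((htime t).1 ht)
      have h2 : ContDiff ℝ 2 (f (t₀ + β * σ)) := (h.smooth _ hσ').of_le (by norm_cast)
      simp only [hG, smul_stPull_apply]
      rw [laplacian_stPull β lam t₀ x₀ f σ y h2, partialDeriv_apply, partialDeriv_apply,
        fderiv_stPull, heRX, hX]
      simp only [_root_.smul_apply, map_smul, smul_eq_mul, hβ]
      rw [← hXdef]
      field_simp
    have hlhs : stPull β lam t₀ x₀ f t y - stPull β lam t₀ x₀ f s y =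
        f (t₀ + β * t) X - f (t₀ + β * s) X := rfl
    have hsub := intervalIntegral.smul_integral_comp_add_mul (a := s) (b := t) G β t₀
    rw [hlhs, hsrc, intervalIntegral.integral_congr hint, intervalIntegral.integral_const_mul,
      ← hsub, smul_eq_mul]

/-- The value of the rescaled scalar at the final time `T` of the box: `F(T, y) = f(t*, z̄e_z + λy)`.
[folklore] -/
theorem stPull_rescale_apply_T (lam tstar zbar T : ℝ) (f : ℝ → ℝ³ → ℝ) (y : ℝ³) :
    stPull (lam ^ 2) lam (tstar - lam ^ 2 * T) (zbar • eZ) f T y = f tstar (zbar • eZ + lam • y) := by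
  simp only [stPull_apply]
  congr 1
  ring

/-- The time correspondence of the rescaling: the box time `s` corresponds to the original time
`t* + λ²(s − T)`. [folklore] -/
theorem stPull_rescale_apply (lam tstar zbar T : ℝ) (f : ℝ → ℝ³ → ℝ) (s : ℝ) (y : ℝ³) :
    stPull (lam ^ 2) lam (tstar - lam ^ 2 * T) (zbar • eZ) f s y =
      f (tstar + lam ^ 2 * (s - T)) (zbar • eZ + lam • y) := by
  simp only [stPull_apply]
  congr 1
  ring

end Rescale

/-! ### The data of Lemma 2.1 on a region away from the axis -/

section Lemma21Data

/-- The radial unit vector has norm at most `1` (`0` on the axis, `1` off it). [folklore] -/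
theorem norm_eR_le_one (x : ℝ³) : ‖eR x‖ ≤ 1 := by
  by_cases hx : cylRadius x = 0
  · simp [eR, hx]
  · have h : ‖eR x‖ ^ 2 = 1 := by rw [← real_inner_self_eq_norm_sq, inner_eR_self hx]
    nlinarith [norm_nonneg (eR x)]

/-- The radial unit vector field is measurable. [folklore] -/
theorem measurable_eR : Measurable (eR : ℝ³ → ℝ³) := by
  have h1 : Measurable fun x : ℝ³ => (cylRadius x)⁻¹ := continuous_cylRadius.measurable.inv
  have h2 : Continuous fun x : ℝ³ => (toLp 2 ![x 0, x 1, 0] : ℝ³) := by fun_prop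
  exact h1.smul h2.measurable

/-- Adding a constant does not change the Laplacian (for a `C²` function). [folklore] -/
theorem laplacian_add_const {g : ℝ³ → ℝ} {x : ℝ³} (hg : ContDiffAt ℝ 2 g x) (m : ℝ) :
    (Δ fun y => g y + m) x = (Δ g) x := by
  have h1 : (fun y => g y + m) = g + fun _ => m := rfl
  rw [h1, hg.laplacian_add contDiffAt_const]
  have h0 : (Δ fun _ : ℝ³ => m) x = 0 := by
    rw [laplacian_eq_iteratedFDeriv_stdOrthonormalBasis]
    simp [iteratedFDeriv_const_of_ne (𝕜 := ℝ) (E := ℝ³) two_ne_zero m]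
  rw [h0, add_zero]

variable {Cf Cu τ : ℝ} {F : ℝ → ℝ³ → ℝ} {V : ℝ → ℝ³ → ℝ³}

/-- **The hypotheses of Lemma 2.1 for a swirl pair on a region away from the axis** (KNSS 2009,
p. 10: "Using this and Lemma 2.1, we see that for any (large) `T₁, L, R` … we can find `λ > 0`
such that `f^λ ≥ M − ε` in `P`"; Lemma 2.1 is applied to the rescaled swirl, shifted by a
constant, on a bounded region at distance `≥ 1/2` from the axis, where the drift of the swirl
equation, `u + (2/r) e_r`, is bounded by `2C_u + 4` uniformly in the scaling). For a swirl pair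
`(F, V)` on `s < τ`, `T < τ`, a constant `m` and `Ω ⊆ {r > 1/2}`: the merged drift
`b = V + (2/r) e_r` is jointly measurable and bounded by `2C_u + 4` on `(0, T] × Ω`, and
`g = F + m` is in the elementary solution class of `KNSS2009_lemma21` on `(0, T] × Ω` with drift
`b`. [cite: KochNadirashviliSereginSverak2009, proof of Thm 5.3, (5.14) (arXiv p. 10)] -/
theorem IsKNSSSwirlPair.lemma21_data (h : IsKNSSSwirlPair Cf Cu τ F V) {T : ℝ} (hT : T < τ)
    (m : ℝ) {Ω : Set ℝ³} (hΩ : ∀ y ∈ Ω, 1 / 2 < cylRadius y) :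
    Measurable (uncurry fun s y => V s y + (2 / cylRadius y) • eR y) ∧
    (∀ s ∈ Ioc 0 T, ∀ y ∈ Ω, ‖V s y + (2 / cylRadius y) • eR y‖ ≤ 2 * Cu + 4) ∧
    (∀ s ∈ Ioc 0 T, ContDiffOn ℝ 2 (fun y => F s y + m) Ω) ∧
    ContinuousOn (fun p : ℝ × ℝ³ => fderiv ℝ (fun y => F p.1 y + m) p.2) (Ioc 0 T ×ˢ Ω) ∧
    ContinuousOn (fun p : ℝ × ℝ³ => (Δ fun y => F p.1 y + m) p.2) (Ioc 0 T ×ˢ Ω) ∧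
    (∀ y ∈ Ω, ∀ s t : ℝ, 0 < s → s ≤ t → t ≤ T →
      (F t y + m) - (F s y + m) = ∫ r in s..t, ((Δ fun y => F r y + m) y -
        fderiv ℝ (fun y => F r y + m) y (V r y + (2 / cylRadius y) • eR y))) := by
  have hCu := h.Cu_nonneg
  have hτ : ∀ s ∈ Ioc (0 : ℝ) T, s < τ := fun s hs => lt_of_le_of_lt hs.2 hT
  have hsub : Ioc (0 : ℝ) T ×ˢ Ω ⊆ Iio τ ×ˢ (univ : Set ℝ³) := fun p hp => ⟨hτ p.1 hp.1, mem_univ _⟩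
  refine ⟨?_, ?_, ?_, ?_, ?_, ?_⟩
  · -- measurability of the merged drift
    have h1 : Measurable fun p : ℝ × ℝ³ => (2 / cylRadius p.2) • eR p.2 :=
      ((measurable_const.div continuous_cylRadius.measurable).comp measurable_snd).smul
        (measurable_eR.comp measurable_snd)
    exact h.measurable_drift.add h1
  · -- the drift bound on `Ω`
    intro s hs y hy
    have hr := hΩ y hy
    have hr0 : 0 < cylRadius y := by linarith
    have hV : ‖V s y‖ ≤ 2 * Cu := by
      have hb := h.drift_le s (hτ s hs) y
      have : ‖V s y‖ ≤ Cu / cylRadius y := by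
        rw [le_div_iff₀ hr0]; linarith [mul_comm (cylRadius y) ‖V s y‖]
      refine this.trans ?_
      rw [div_le_iff₀ hr0]
      nlinarith
    have hE : ‖(2 / cylRadius y) • eR y‖ ≤ 4 := by
      rw [norm_smul, Real.norm_eq_abs, abs_of_nonneg (by positivity)]
      have h1 : 2 / cylRadius y ≤ 4 := by
        rw [div_le_iff₀ hr0]; linarith
      have h2 := norm_eR_le_one y
      calc 2 / cylRadius y * ‖eR y‖ ≤ 4 * 1 := by gcongr
        _ = 4 := by ring
    exact (norm_add_le _ _).trans (by linarith)
  · -- `C²` slices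
    intro s hs
    exact (((h.smooth s (hτ s hs)).of_le (by norm_cast)).add contDiff_const).contDiffOn
  · -- `∇g = ∇F`
    refine (h.continuousOn_fderiv.mono hsub).congr fun p _ => ?_
    exact fderiv_add_const m
  · -- `Δg = ΔF`
    refine (h.continuousOn_laplacian.mono hsub).congr fun p hp => ?_
    exact laplacian_add_const ((h.smooth p.1 (hτ p.1 hp.1)).of_le (by norm_cast)).contDiffAt m
  · -- the equation with the merged drift
    intro y hy s t hs hst htT
    have hr := hΩ y hy
    have hy0 : cylRadius y ≠ 0 := by linarith
    have ht : t < τ := lt_of_le_of_lt htT hT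
    rw [add_sub_add_right_eq_sub, h.eqn y hy0 s t hst ht]
    refine intervalIntegral.integral_congr fun r hr' => ?_
    rw [uIcc_of_le hst] at hr'
    have hrτ : r < τ := lt_of_le_of_lt (hr'.2.trans htT) hT
    have h2 : ContDiffAt ℝ 2 (F r) y := ((h.smooth r hrτ).of_le (by norm_cast)).contDiffAt
    simp only [laplacian_add_const h2, fderiv_add_const, map_add, map_smul, smul_eq_mul,
      partialDeriv_apply]
    ring

end Lemma21Data

end Literature.Analysis.FluidPDE

end
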